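import Summits.NavierStokesRegularity.NavierStokesRegularity.Theorems.SqueezeCycleExtremalBiaxialitySubcriticalCruxIffStub
import Summits.NavierStokesRegularity.NavierStokesRegularity.Theorems.SqueezeCycleExtremalBiaxialitySubcriticalMustSqueezeFamily
import Summits.NavierStokesRegularity.NavierStokesRegularity.Theorems.SqueezeCycleMustSqueeze
import Summits.NavierStokesRegularity.NavierStokesRegularity.Theorems.ExtremalBiaxialitySubcritical.Negative.NoSlack
import HarnessLib

/-!
# Route `SqueezeCycle`, crux `ExtremalBiaxialitySubcritical` — the quarter law at the CLOSED
# threshold, and the unconditional status of line `quarter-bootstrap-pinning`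

Helper file for item `stmt-NavierStokesRegularity-11609`
(`Summit.NavierStokesRegularity.NavierStokesRegularity.Theses.SqueezeCycle.ExtremalBiaxialitySubcritical`),
line `quarter-bootstrap-pinning` (third lead, a1).

The line's three landed stubs — the class-uniform gauge strain bound `|S|²_F ≤ (K(C)/(−t))²`
(`stub_gaugeStrainBound`, p72389), the cubic production ceiling
`−4 det S ≤ (2m − 4m³/K²)|S|²_F` under `λ₂ ≤ m`, `|S| ≤ K` (`stub_cubicProductionBound`, p72572) and
the leaky quarter law in production currency for every `b < ¼` (`stub_leakyQuarterLawCeiling`,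
p77091) — buy, besides the bookkeeping sliver of the bootstrap, exactly ONE class-free theorem
about the Type-I model class `𝒦_C`, recorded here:

* `mustSqueezeAt_quarter` — **the quarter law holds at the closed threshold `¼`**: an element of
  `𝒦_C` whose Leray-gauge middle strain eigenvalue is `≤ ¼` at EVERY point vanishes identically.
  (The Λ-currency engine of the sibling crux `MustSqueeze` needs the open margin `¼ − a > 0`,
  `mustSqueeze_family`; at `a = ¼` the margin is supplied by the cubic pinning term `2(¼)³/K²` of
  this line: with `K ≥ max(K(C), 1)` the ceiling `Λ ≤ ¼` is a production ceiling at
  `b = ¼ − 1/(32K²) < ¼`.)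
* `exists_lerayMiddleStrain_gt_quarter` — hence every element of `𝒦_C` that is not identically
  zero on `t < 0` has a point with `Λ > ¼` STRICTLY, and (`classMax_gap_strict`) an attained
  class-wide maximum `m` of `Λ` satisfies `m ≤ 0 ∨ ¼ < m` (sharpening `Negative.classMax_gap`,
  `m ≤ 0 ∨ ¼ ≤ m`).
* Status, now UNCONDITIONAL since `MustSqueeze` is proved (`squeezeCycle_mustSqueeze_proof`):
  `extremalBiaxialitySubcritical_iff_squeezeLiouville` (crux ⇔ route target X),
  `largeExcessExclusion_iff_squeezeLiouville` (the line's single open stub, registered signature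
  VERBATIM, ⇔ X) and `squeezeLiouville_iff_forall_lerayMiddleStrain_le_quarter`
  (X ⇔ "`Λ ≤ ¼` at every point of every element of every `𝒦_C`").
So the open stub of the line is the Type-I Liouville problem on `𝒦_C` itself, with no slack and no
remaining lever inside the line: the line is closed modulo X. [cite: Miller2019, Thm 1.1;
KNSS2009, Prop 4.1]
-/

noncomputable section

set_option linter.dupNamespace false

open MeasureTheory Set Filter Topology
open scoped RealInnerProductSpace Matrix

namespace Summit.NavierStokesRegularity.NavierStokesRegularity.Theorems

open Literature.Analysis.FluidPDE
open Summit.NavierStokesRegularity.NavierStokesRegularity.Theses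
open Summit.NavierStokesRegularity.NavierStokesRegularity.Theses.SqueezeCycle
open Summit.NavierStokesRegularity.NavierStokesRegularity.Theorems.ExtremalBiaxialitySubcritical.Negative

/-! ### The quarter law at the closed threshold -/

/-- **The quarter law at the closed threshold `¼`.** An element `u` of the Type-I model class
`𝒦_C` whose Leray-gauge middle strain eigenvalue satisfies `Λ_u(t,x) ≤ ¼` at every `t < 0`, `x`
(two-frame form, as in `MustSqueeze`) vanishes identically on `t < 0`. Proof: take the class strain
constant `K(C)` (`stub_gaugeStrainBound`) enlarged to `K ≥ 1`, so `6(¼)² ≤ K²`; at every point the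
ceiling `μ₁ ≤ 2·(¼)/(−t)` and `|S|²_F ≤ (K/(−t))²` feed `stub_cubicProductionBound`, giving the
production ceiling `−4 det S ≤ (2b/(−t))|S|²_F` with `b = ¼ − 2(¼)³/K² < ¼`, and
`stub_leakyQuarterLawCeiling` kills `u`. [cite: Miller2019, Thm 1.1] -/
theorem mustSqueezeAt_quarter : ∀ (C : ℝ) (u : ℝ → EuclideanSpace ℝ (Fin 3) → EuclideanSpace ℝ (Fin 3)), ContDiffOn ℝ (⊤ : ℕ∞) (Function.uncurry u) (Set.Iio 0 ×ˢ Set.univ) ∧ (∀ t < 0, Literature.Analysis.FluidPDE.VectorCalculus.IsDivFree (u t)) ∧ (∀ s t : ℝ, s < t → t < 0 → ∀ x, u t x = Literature.Analysis.FluidPDE.heatFlow (u s) (t-s) x - ∫ τ in Set.Ioo s t, ∫ y, ((-(inner ℝ (x-y) (u τ y) / (2*(t-τ)) * Literature.Analysis.UnboundedOperators.heatKernel (t-τ) (x-y))) • u τ y + (∫ σ in Set.Ioi (t-τ), Literature.Analysis.UnboundedOperators.heatKernel σ (x-y) / (4*σ^2)) • (inner ℝ (x-y) (u τ y) • u τ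 y + inner ℝ (u τ y) (u τ y) • (x-y) + inner ℝ (x-y) (u τ y) • u τ y) - ((∫ σ in Set.Ioi (t-τ), Literature.Analysis.UnboundedOperators.heatKernel σ (x-y) / (8*σ^3)) * (inner ℝ (x-y) (u τ y) * inner ℝ (x-y) (u τ y))) • (x-y))) ∧ Literature.Analysis.FluidPDE.HasTypeITimeDecay C u ∧ (∀ (x₀ : EuclideanSpace ℝ (Fin 3)) (t₀ r : ℝ), t₀ ≤ 0 → 0 < r → (∀ t, t₀ - r^2 < t → t < t₀ → r⁻¹ * ∫ x in Metric.ball x₀ r, ‖u t x‖^2 ≤ C) ∧ r⁻¹ * ∫ t in Set.Ioo (t₀ - r^2) t₀, ∫ x in Metric.ball x₀ r, ‖fderiv ℝ (u t) x‖^2 ≤ C) → (∀ t < 0, ∀ x, (∃ v w : EuclideanSpace ℝ (Fin 3), ‖v‖ = 1 ∧ ‖w‖ = 1 ∧ inner ℝ v w = 0 ∧ ∀ α β : ℝ, (-t) * inner ℝ (fderiv ℝ (u t) x (α • v + β • w)) (α • v + β • w) ≤ (1 / 4 : ℝ) * (α^2 + β^2))) → ∀ t < 0, ∀ x, u t x =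 0 := by
  intro C u hu hΛ
  obtain ⟨K₀, hK₀, hKb₀⟩ := stub_gaugeStrainBound C
  obtain ⟨h1, h2, h3, h4, h5⟩ := hu
  -- enlarge the class strain constant to `K ≥ 1`
  set K : ℝ := max K₀ 1 with hKdef
  have hK1 : (1 : ℝ) ≤ K := le_max_right _ _
  have hK : 0 < K := lt_of_lt_of_le one_pos hK1
  have hK₀K : K₀ ≤ K := le_max_left _ _
  -- the ceiling in `lerayMiddleStrain` form
  have hΛle : ∀ t < 0, ∀ x, lerayMiddleStrain u t x ≤ 1 / 4 := fun t ht x =>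
    (lerayMiddleStrain_le_iff ht (1 / 4)).2 (hΛ t ht x)
  -- trace-free velocity gradients
  have htr : ∀ t < 0, ∀ x, (stdMatrix (fderiv ℝ (u t) x : EuclideanSpace ℝ (Fin 3) →ₗ[ℝ] EuclideanSpace ℝ (Fin 3))).trace = 0 := by
    intro t ht x
    rw [trace_stdMatrix]
    exact h2 t ht x
  -- the excess at the closed threshold
  set b : ℝ := 1 / 4 - 2 * (1 / 4) ^ 3 / K ^ 2 with hb
  have hb4 : b < 1 / 4 := by
    have hpos : 0 < 2 * (1 / 4 : ℝ) ^ 3 / K ^ 2 := by positivity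
    rw [hb]
    linarith
  have h6 : 6 * (1 / 4 : ℝ) ^ 2 ≤ K ^ 2 := by nlinarith [hK1]
  -- the production ceiling at every point of `u`
  have hceil : ∀ t < 0, ∀ x,
      -4 * (((1 / 2 : ℝ) • (Literature.Analysis.FluidPDE.stdMatrix (fderiv ℝ (u t) x : EuclideanSpace ℝ (Fin 3) →ₗ[ℝ] EuclideanSpace ℝ (Fin 3)) + (Literature.Analysis.FluidPDE.stdMatrix (fderiv ℝ (u t) x : EuclideanSpace ℝ (Fin 3) →ₗ[ℝ] EuclideanSpace ℝ (Fin 3)))ᵀ))).det ≤ (2 * b / (-t)) * (∑ i, ∑ j, (((1 / 2 : ℝ) • (Literature.Analysis.FluidPDE.stdMatrix (fderiv ℝ (u t) x : EuclideanSpace ℝ (Fin 3) →ₗ[ℝ] EuclideanSpace ℝ (Fin 3)) + (Literature.Analysis.FluidPDE.stdMatrix (fderiv ℝ (u t) x : EuclideanSpace ℝ (Fin 3) →ₗ[ℝ] EuclideanSpace ℝ (Fin 3)))ᵀ)) i j) ^ 2) := by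
    intro t ht x
    have ht' : 0 < -t := neg_pos.2 ht
    set M := stdMatrix (fderiv ℝ (u t) x : EuclideanSpace ℝ (Fin 3) →ₗ[ℝ] EuclideanSpace ℝ (Fin 3)) with hM
    -- the ceiling `μ₁ ≤ 2 (1/4) / (-t)` from `Λ_u(t,x) ≤ 1/4`
    have hΛle_u : lerayMiddleStrain u t x ≤ 1 / 4 := hΛle t ht x
    have hΛ : lerayMiddleStrain u t x =
        (-t) * (2⁻¹ * (Matrix.isHermitian_add_transpose_self M).eigenvalues₀ 1) :=
      lerayMiddleStrain_eq_eigenvalues₀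
    have hμ : (Matrix.isHermitian_add_transpose_self M).eigenvalues₀ 1 ≤ 2 * ((1 / 4) / (-t)) := by
      rw [hΛ] at hΛle_u
      rw [mul_div_assoc', le_div_iff₀ ht']
      nlinarith
    -- the strain bound with the enlarged constant
    have hS₀ := hKb₀ u ⟨h1, h2, h3, h4, h5⟩ t ht x
    have hKK : (K₀ / (-t)) ^ 2 ≤ (K / (-t)) ^ 2 := by
      have e1 : (K₀ / (-t)) ^ 2 = K₀ ^ 2 / (-t) ^ 2 := by ring
      have e2 : (K / (-t)) ^ 2 = K ^ 2 / (-t) ^ 2 := by ring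
      rw [e1, e2]
      exact div_le_div_of_nonneg_right (by nlinarith) (sq_nonneg _)
    have hS : (∑ i, ∑ j, (((1 / 2 : ℝ) • (Literature.Analysis.FluidPDE.stdMatrix (fderiv ℝ (u t) x : EuclideanSpace ℝ (Fin 3) →ₗ[ℝ] EuclideanSpace ℝ (Fin 3)) + (Literature.Analysis.FluidPDE.stdMatrix (fderiv ℝ (u t) x : EuclideanSpace ℝ (Fin 3) →ₗ[ℝ] EuclideanSpace ℝ (Fin 3)))ᵀ)) i j) ^ 2) ≤ (K / (-t)) ^ 2 := hS₀.trans hKK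
    have hmK : 6 * ((1 / 4) / (-t)) ^ 2 ≤ (K / (-t)) ^ 2 := by
      have e1 : 6 * ((1 / 4 : ℝ) / (-t)) ^ 2 = (6 * (1 / 4 : ℝ) ^ 2) / (-t) ^ 2 := by ring
      have e2 : (K / (-t)) ^ 2 = K ^ 2 / (-t) ^ 2 := by ring
      rw [e1, e2]
      exact div_le_div_of_nonneg_right h6 (sq_nonneg _)
    have hcub := stub_cubicProductionBound M ((1 / 4) / (-t)) (K / (-t)) (htr t ht x)
      (div_nonneg (by norm_num) ht'.le) (div_pos hK ht') hmK hμ hS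
    have hcoef : 2 * ((1 / 4) / (-t)) - 4 * ((1 / 4) / (-t)) ^ 3 / (K / (-t)) ^ 2 = 2 * b / (-t) := by
      rw [hb]
      field_simp
      ring
    rw [hcoef] at hcub
    exact hcub
  -- the leaky quarter law kills `u`
  exact stub_leakyQuarterLawCeiling C b hb4 u ⟨h1, h2, h3, h4, h5⟩ hceil

/-- **Every element of `𝒦_C` that does not vanish identically squeezes strictly harder than `¼`
somewhere**: some point `(t, x)`, `t < 0`, has `Λ_u(t,x) > ¼` (contrapositive of
`mustSqueezeAt_quarter`, Courant–Fischer bridge `lerayMiddleStrain_le_iff`). [folklore] -/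
theorem exists_lerayMiddleStrain_gt_quarter {C : ℝ} {u : ℝ → EuclideanSpace ℝ (Fin 3) → EuclideanSpace ℝ (Fin 3)}
    (hu : ContDiffOn ℝ (⊤ : ℕ∞) (Function.uncurry u) (Set.Iio 0 ×ˢ Set.univ) ∧ (∀ t < 0, Literature.Analysis.FluidPDE.VectorCalculus.IsDivFree (u t)) ∧ (∀ s t : ℝ, s < t → t < 0 → ∀ x, u t x = Literature.Analysis.FluidPDE.heatFlow (u s) (t-s) x - ∫ τ in Set.Ioo s t, ∫ y, ((-(inner ℝ (x-y) (u τ y) / (2*(t-τ)) * Literature.Analysis.UnboundedOperators.heatKernel (t-τ) (x-y))) • u τ y + (∫ σ in Set.Ioi (t-τ), Literature.Analysis.UnboundedOperators.heatKernel σ (x-y) / (4*σ^2)) • (inner ℝ (x-y) (u τ y) • u τ y + inner ℝ (u τ y) (u τ y) • (x-y) + inner ℝ (x-y) (u τ y) • u τ y) - ((∫ σ in Set.Ioi (t-τ), Literature.Analysis.UnboundedOperators.heatKernel σ (x-y) / (8*σ^3)) * (inner ℝ (x-y) (u τ y) * inner ℝ (x-y) (u τ y))) • (x-y))) ∧ Literature.Analysis.FluidPDE.HasTypeITimeDecay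 C u ∧ (∀ (x₀ : EuclideanSpace ℝ (Fin 3)) (t₀ r : ℝ), t₀ ≤ 0 → 0 < r → (∀ t, t₀ - r^2 < t → t < t₀ → r⁻¹ * ∫ x in Metric.ball x₀ r, ‖u t x‖^2 ≤ C) ∧ r⁻¹ * ∫ t in Set.Ioo (t₀ - r^2) t₀, ∫ x in Metric.ball x₀ r, ‖fderiv ℝ (u t) x‖^2 ≤ C))
    (hne : ∃ t < 0, ∃ x, u t x ≠ 0) : ∃ t < 0, ∃ x, 1 / 4 < lerayMiddleStrain u t x := by
  by_contra h
  push Not at h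
  obtain ⟨t, ht, x, hx⟩ := hne
  exact hx (mustSqueezeAt_quarter C u hu
    (fun s hs y => (lerayMiddleStrain_le_iff hs (1 / 4)).1 (h s hs y)) t ht x)

/-- **Sharpened spectral gap**: at an extremal configuration of the crux (element `u ∈ 𝒦_C`
attaining a class-wide maximal value `m` of `Λ` at `(t₀, x₀)`, `t₀ < 0`) either `m ≤ 0` or
`¼ < m` STRICTLY (`Negative.classMax_gap` with the proved family `mustSqueeze_family` gives
`m ≤ 0 ∨ ¼ ≤ m`; the value `m = ¼` is excluded by `mustSqueezeAt_quarter` applied to the maximiser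
and `nonpos_of_twoFrame_lower_of_slice_zero`). [folklore] -/
theorem classMax_gap_strict {C m : ℝ} {u : ℝ → EuclideanSpace ℝ (Fin 3) → EuclideanSpace ℝ (Fin 3)} {t₀ : ℝ} {x₀ : EuclideanSpace ℝ (Fin 3)}
    (ht₀ : t₀ < 0)
    (hu : ContDiffOn ℝ (⊤ : ℕ∞) (Function.uncurry u) (Set.Iio 0 ×ˢ Set.univ) ∧ (∀ t < 0, Literature.Analysis.FluidPDE.VectorCalculus.IsDivFree (u t)) ∧ (∀ s t : ℝ, s < t → t < 0 → ∀ x, u t x = Literature.Analysis.FluidPDE.heatFlow (u s) (t-s) x - ∫ τ in Set.Ioo s t, ∫ y, ((-(inner ℝ (x-y) (u τ y) / (2*(t-τ)) * Literature.Analysis.UnboundedOperators.heatKernel (t-τ) (x-y))) • u τ y + (∫ σ in Set.Ioi (t-τ), Literature.Analysis.UnboundedOperators.heatKernel σ (x-y) / (4*σ^2)) • (inner ℝ (x-y) (u τ y) • u τ y + inner ℝ (u τ y) (u τ y) • (x-y) + inner ℝ (x-y) (u τ y) • u τ y) - ((∫ σ in Set.Ioi (t-τ), Literature.Analysis.UnboundedOperators.heatKernel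 σ (x-y) / (8*σ^3)) * (inner ℝ (x-y) (u τ y) * inner ℝ (x-y) (u τ y))) • (x-y))) ∧ Literature.Analysis.FluidPDE.HasTypeITimeDecay C u ∧ (∀ (x₀ : EuclideanSpace ℝ (Fin 3)) (t₀ r : ℝ), t₀ ≤ 0 → 0 < r → (∀ t, t₀ - r^2 < t → t < t₀ → r⁻¹ * ∫ x in Metric.ball x₀ r, ‖u t x‖^2 ≤ C) ∧ r⁻¹ * ∫ t in Set.Ioo (t₀ - r^2) t₀, ∫ x in Metric.ball x₀ r, ‖fderiv ℝ (u t) x‖^2 ≤ C))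
    (hGE : (∃ v w : EuclideanSpace ℝ (Fin 3), ‖v‖ = 1 ∧ ‖w‖ = 1 ∧ inner ℝ v w = 0 ∧ ∀ α β : ℝ, m * (α^2 + β^2) ≤ (-t₀) * inner ℝ (fderiv ℝ (u t₀) x₀ (α • v + β • w)) (α • v + β • w)))
    (hmax : ∀ v' : ℝ → EuclideanSpace ℝ (Fin 3) → EuclideanSpace ℝ (Fin 3), ContDiffOn ℝ (⊤ : ℕ∞) (Function.uncurry v') (Set.Iio 0 ×ˢ Set.univ) ∧ (∀ t < 0, Literature.Analysis.FluidPDE.VectorCalculus.IsDivFree (v' t)) ∧ (∀ s t : ℝ, s < t → t < 0 → ∀ x, v' t x = Literature.Analysis.FluidPDE.heatFlow (v' s) (t-s) x - ∫ τ in Set.Ioo s t, ∫ y, ((-(inner ℝ (x-y) (v' τ y) / (2*(t-τ)) * Literature.Analysis.UnboundedOperators.heatKernel (t-τ) (x-y))) • v' τ y + (∫ σ in Set.Ioi (t-τ), Literature.Analysis.UnboundedOperators.heatKernel σ (x-y) / (4*σ^2)) • (inner ℝ (x-y) (v' τ y) • v' τ y + inner ℝ (v' τ y) (v' τ y) • (x-y)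 + inner ℝ (x-y) (v' τ y) • v' τ y) - ((∫ σ in Set.Ioi (t-τ), Literature.Analysis.UnboundedOperators.heatKernel σ (x-y) / (8*σ^3)) * (inner ℝ (x-y) (v' τ y) * inner ℝ (x-y) (v' τ y))) • (x-y))) ∧ Literature.Analysis.FluidPDE.HasTypeITimeDecay C v' ∧ (∀ (x₀ : EuclideanSpace ℝ (Fin 3)) (t₀ r : ℝ), t₀ ≤ 0 → 0 < r → (∀ t, t₀ - r^2 < t → t < t₀ → r⁻¹ * ∫ x in Metric.ball x₀ r, ‖v' t x‖^2 ≤ C) ∧ r⁻¹ * ∫ t in Set.Ioo (t₀ - r^2) t₀, ∫ x in Metric.ball x₀ r, ‖fderiv ℝ (v' t) x‖^2 ≤ C) → ∀ t < 0, ∀ x, (∃ v w : EuclideanSpace ℝ (Fin 3), ‖v‖ = 1 ∧ ‖w‖ = 1 ∧ inner ℝ v w = 0 ∧ ∀ α β : ℝ, (-t) * inner ℝ (fderiv ℝ (v' t) x (α • v + β • w)) (α • v + β • w) ≤ m * (α^2 + β^2))) :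
    m ≤ 0 ∨ 1 / 4 < m := by
  rcases classMax_gap mustSqueeze_family ht₀ hu hGE hmax with h | h
  · exact Or.inl h
  · rcases h.eq_or_lt with rfl | h
    · left
      have hz : ∀ x, u t₀ x = 0 := fun x => mustSqueezeAt_quarter C u hu (hmax u hu) t₀ ht₀ x
      exact nonpos_of_twoFrame_lower_of_slice_zero hz hGE
    · exact Or.inr h

/-! ### Unconditional status of the crux and of the line's open stub -/

/-- **The crux IS the route target**: `ExtremalBiaxialitySubcritical ⇔ SqueezeLiouville`
(Type-I Liouville on `𝒦_C`), unconditionally — `Negative.crux_iff_squeezeLiouville` discharged by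
the proved sibling crux `squeezeCycle_mustSqueeze_proof`. [folklore] -/
theorem extremalBiaxialitySubcritical_iff_squeezeLiouville :
    SqueezeCycle.ExtremalBiaxialitySubcritical ↔ SqueezeCycle.SqueezeLiouville :=
  crux_iff_squeezeLiouville squeezeCycle_mustSqueeze_proof

/-- **The single open stub of line `quarter-bootstrap-pinning` IS the route target**:
`stub_largeExcessExclusion` (registered signature, VERBATIM) `⇔ SqueezeLiouville`
(`extremalBiaxialitySubcritical_iff_largeExcessExclusion` and the previous theorem). [folklore] -/
theorem largeExcessExclusion_iff_squeezeLiouville :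
    (∀ (C K m : ℝ) (u : ℝ → EuclideanSpace ℝ (Fin 3) → EuclideanSpace ℝ (Fin 3)) (t₀ : ℝ) (x₀ : EuclideanSpace ℝ (Fin 3)), 0 < K → (∀ (v' : ℝ → EuclideanSpace ℝ (Fin 3) → EuclideanSpace ℝ (Fin 3)), ContDiffOn ℝ (⊤ : ℕ∞) (Function.uncurry v') (Set.Iio 0 ×ˢ Set.univ) ∧ (∀ t < 0, Literature.Analysis.FluidPDE.VectorCalculus.IsDivFree (v' t)) ∧ (∀ s t : ℝ, s < t → t < 0 → ∀ x, v' t x = Literature.Analysis.FluidPDE.heatFlow (v' s) (t-s) x - ∫ τ in Set.Ioo s t, ∫ y, ((-(inner ℝ (x-y) (v' τ y) / (2*(t-τ)) * Literature.Analysis.UnboundedOperators.heatKernel (t-τ) (x-y))) • v' τ y + (∫ σ in Set.Ioi (t-τ), Literature.Analysis.UnboundedOperators.heatKernel σ (x-y) / (4*σ^2)) • (inner ℝ (x-y) (v' τ y) • v' τ y + inner ℝ (v' τ y) (v' τ y) • (x-y) + inner ℝ (x-y) (v' τ y) • v' τ y) - ((∫ σ in Set.Ioi (t-τ), Literature.Analysis.UnboundedOperators.heatKernel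 σ (x-y) / (8*σ^3)) * (inner ℝ (x-y) (v' τ y) * inner ℝ (x-y) (v' τ y))) • (x-y))) ∧ Literature.Analysis.FluidPDE.HasTypeITimeDecay C v' ∧ (∀ (x₀ : EuclideanSpace ℝ (Fin 3)) (t₀ r : ℝ), t₀ ≤ 0 → 0 < r → (∀ t, t₀ - r^2 < t → t < t₀ → r⁻¹ * ∫ x in Metric.ball x₀ r, ‖v' t x‖^2 ≤ C) ∧ r⁻¹ * ∫ t in Set.Ioo (t₀ - r^2) t₀, ∫ x in Metric.ball x₀ r, ‖fderiv ℝ (v' t) x‖^2 ≤ C) → ∀ t < 0, ∀ x, (∑ i, ∑ j, (((1 / 2 : ℝ) • (Literature.Analysis.FluidPDE.stdMatrix (fderiv ℝ (v' t) x : EuclideanSpace ℝ (Fin 3) →ₗ[ℝ] EuclideanSpace ℝ (Fin 3)) + (Literature.Analysis.FluidPDE.stdMatrix (fderiv ℝ (v' t) x : EuclideanSpace ℝ (Fin 3) →ₗ[ℝ] EuclideanSpace ℝ (Fin 3)))ᵀ)) i j) ^ 2) ≤ (K / (-t)) ^ 2 ∧ Literature.Analysis.FluidPDE.lerayMiddleStrain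 v' t x ≤ m) → 0 ≤ m → 1 / 4 ≤ m - 2 * m ^ 3 / K ^ 2 → t₀ < 0 → (ContDiffOn ℝ (⊤ : ℕ∞) (Function.uncurry u) (Set.Iio 0 ×ˢ Set.univ) ∧ (∀ t < 0, Literature.Analysis.FluidPDE.VectorCalculus.IsDivFree (u t)) ∧ (∀ s t : ℝ, s < t → t < 0 → ∀ x, u t x = Literature.Analysis.FluidPDE.heatFlow (u s) (t-s) x - ∫ τ in Set.Ioo s t, ∫ y, ((-(inner ℝ (x-y) (u τ y) / (2*(t-τ)) * Literature.Analysis.UnboundedOperators.heatKernel (t-τ) (x-y))) • u τ y + (∫ σ in Set.Ioi (t-τ), Literature.Analysis.UnboundedOperators.heatKernel σ (x-y) / (4*σ^2)) • (inner ℝ (x-y) (u τ y) • u τ y + inner ℝ (u τ y) (u τ y) • (x-y) + inner ℝ (x-y) (u τ y) • u τ y) - ((∫ σ in Set.Ioi (t-τ), Literature.Analysis.UnboundedOperators.heatKernel σ (x-y) / (8*σ^3)) * (inner ℝ (x-y) (u τ y) * inner ℝ (x-y) (u τ y))) • (x-y))) ∧ Literature.Analysis.FluidPDE.HasTypeITimeDecay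 C u ∧ (∀ (x₀ : EuclideanSpace ℝ (Fin 3)) (t₀ r : ℝ), t₀ ≤ 0 → 0 < r → (∀ t, t₀ - r^2 < t → t < t₀ → r⁻¹ * ∫ x in Metric.ball x₀ r, ‖u t x‖^2 ≤ C) ∧ r⁻¹ * ∫ t in Set.Ioo (t₀ - r^2) t₀, ∫ x in Metric.ball x₀ r, ‖fderiv ℝ (u t) x‖^2 ≤ C)) → m ≤ Literature.Analysis.FluidPDE.lerayMiddleStrain u t₀ x₀ → False) ↔ SqueezeCycle.SqueezeLiouville :=
  extremalBiaxialitySubcritical_iff_largeExcessExclusion.symm.trans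
    extremalBiaxialitySubcritical_iff_squeezeLiouville

/-- **The target as the CLOSED quarter a-priori bound**: Liouville on the Type-I model class holds
iff the Leray-gauge middle strain eigenvalue of every element of every `𝒦_C` is `≤ ¼` at every
point (`⇒`: the strict form `Negative.squeezeLiouville_iff_forall_lerayMiddleStrain_lt_quarter`
with `mustSqueeze_family`; `⇐`: `mustSqueezeAt_quarter`). [folklore] -/
theorem squeezeLiouville_iff_forall_lerayMiddleStrain_le_quarter :
    SqueezeCycle.SqueezeLiouville ↔
      ∀ (C : ℝ) (u : ℝ → EuclideanSpace ℝ (Fin 3) → EuclideanSpace ℝ (Fin 3)), (ContDiffOn ℝ (⊤ : ℕ∞) (Function.uncurry u) (Set.Iio 0 ×ˢ Set.univ) ∧ (∀ t < 0, Literature.Analysis.FluidPDE.VectorCalculus.IsDivFree (u t)) ∧ (∀ s t : ℝ, s < t → t < 0 → ∀ x, u t x = Literature.Analysis.FluidPDE.heatFlow (u s) (t-s) x - ∫ τ in Set.Ioo s t, ∫ y, ((-(inner ℝ (x-y) (u τ y) / (2*(t-τ)) * Literature.Analysis.UnboundedOperators.heatKernel (t-τ) (x-y))) • u τ y + (∫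 σ in Set.Ioi (t-τ), Literature.Analysis.UnboundedOperators.heatKernel σ (x-y) / (4*σ^2)) • (inner ℝ (x-y) (u τ y) • u τ y + inner ℝ (u τ y) (u τ y) • (x-y) + inner ℝ (x-y) (u τ y) • u τ y) - ((∫ σ in Set.Ioi (t-τ), Literature.Analysis.UnboundedOperators.heatKernel σ (x-y) / (8*σ^3)) * (inner ℝ (x-y) (u τ y) * inner ℝ (x-y) (u τ y))) • (x-y))) ∧ Literature.Analysis.FluidPDE.HasTypeITimeDecay C u ∧ (∀ (x₀ : EuclideanSpace ℝ (Fin 3)) (t₀ r : ℝ), t₀ ≤ 0 → 0 < r → (∀ t, t₀ - r^2 < t → t < t₀ → r⁻¹ * ∫ x in Metric.ball x₀ r, ‖u t x‖^2 ≤ C) ∧ r⁻¹ * ∫ t in Set.Ioo (t₀ - r^2) t₀, ∫ x in Metric.ball x₀ r, ‖fderiv ℝ (u t) x‖^2 ≤ C)) →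
        ∀ t < 0, ∀ x, lerayMiddleStrain u t x ≤ 1 / 4 := by
  constructor
  · intro hL C u hu t ht x
    exact ((squeezeLiouville_iff_forall_lerayMiddleStrain_lt_quarter mustSqueeze_family).1 hL
      C u hu t ht x).le
  · intro h C u hu
    exact mustSqueezeAt_quarter C u hu
      (fun t ht x => (lerayMiddleStrain_le_iff ht (1 / 4)).1 (h C u hu t ht x))

end Summit.NavierStokesRegularity.NavierStokesRegularity.Theorems

end
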